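import Summits.QuantumFields.BalabanUV.T4Continuum.Support.NE3CovariantLineSumGauge
import Summits.QuantumFields.BalabanUV.T4Continuum.Support.NE3CovariantLineSplit
import Summits.QuantumFields.BalabanUV.T4Continuum.Support.NE3CovariantBlockDivergence
import Summits.QuantumFields.BalabanUV.T4Continuum.Support.AveragingDeficitHSInner
import HarnessLib

/-!
# T⁴ programme, node NE3 — route H♮ (ruling ρ-g22-2), row K6 input K6-tr: THE DISCRETE COVARIANT TRACE INEQUALITY ON A BLOCK —
# `Σ_t nhsNormSq (η (M•z + t + (M−1)e_κ) κ) ≤ 2·(M⁻¹·Σ_{v∈B} nhsNormSq (η (M•z+v) κ) + M·Σ_{v∈B} nhsNormSq (covFd W η (M•z+v) κ κ))`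

NE3 (node U1b), row NE3 OWNER `b2b-balaban-t4-ne3-p1` (gen 23); booked by RULING ρ-g23-3 (journal l.19107, blueprint
`HOME/t4/b2b-balaban-t4-ne3-p1/g23/D-ne3p1-g23-1.md` §2): the `ℓ¹(face) → ℓ²` step of the three FACE pairings of K4-c∕K4-d2
(`farDefect`, `nearDefect`, `coarseMismatch`, and the face jump of the non-exact part `E`) needs the face values of `η′` controlled by the
block `ℓ²` mass AND the `κ`-gradient — otherwise a bare `M^{1∕2}` appears (forbidden by SHAPE K4's CONSTANT TARGET).

WHAT.  For a block `B(z)` (corner `q = M•z`, side `M ≥ 1`), a direction `κ`, a unitary `W` and any fine 1-form `η`: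
§1 the 1D inequality for a finite sequence of matrices `f : ℕ → Matrix n n ℂ` in nhs currency:
   `nhsNormSq (f (M−1)) ≤ (2∕M)·Σ_{j<M} nhsNormSq (f j) + 2M·Σ_{j<M} nhsNormSq (f (j+1) − f j)` (telescoping from every `j`, Cauchy–Schwarz
   `nhsNormSq (Σ) ≤ # · Σ nhsNormSq` of K4-d1's `NE3CovariantLineSumGauge`, averaging over `j`);
§2 the covariant instance: read the `κ`-component along the `κ`-line `q + t + j•e_κ` in the corner frame through K4-b's `cornerToBond`
   (step law `cornerToBond_add_e`: consecutive readings differ by the TRANSPORTED covariant difference, `nhsNormSq` equal to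
   `nhsNormSq (covFd W η y κ κ)`; values isometric), giving per line
   `nhsNormSq (η (q+t+(M−1)e_κ) κ) ≤ (2∕M)·Σ_{j<M} nhsNormSq (η (q+t+je_κ) κ) + 2M·Σ_{j<M} nhsNormSq (covFd W η (q+t+je_κ) κ κ)`,
   and summed over the transverse offsets through the split chart (K4-c's `sum_periodBox_eq_sum_split`) **`sum_nhsNormSq_farFace_le`**;
   the NEAR face of `B(z)` is the far face of `B(z − e_κ)` (`sum_nhsNormSq_nearFace_le`, the rewriting `M•(z−e_κ)+t+(M−1)e_κ = M•z+t−e_κ`).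
No smallness, no gauge fixing; any unitary `W`.

HONEST FRAMING.  Elementary lattice bookkeeping on OUR typed objects; nothing about Bałaban's minimisers; (P♮)_W, (ML_w) at W ≠ 1, T-E_w
and NE3 are NOT proved; spine PROVED 0∕9; finite T⁴ rung (B)+1 — NOT infinite volume, NOT mass gap, NOT BetaPertH, NOT Clay.  ABSOLUTE RULE
kept (context only: [Balaban1985PropagatorsII] (3.46)).  PLACEMENT: `Summits/QuantumFields/BalabanUV/`; imports accepted modules only.
-/

set_option autoImplicit false

open scoped BigOperators Matrix.Norms.L2Operator
open Finset

namespace Summit.QuantumFields.BalabanUV.T4Continuum.NE3CovariantBlockTrace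

open Literature.MathematicalPhysics.QuantumFieldTheory.Balaban1983to89
open B7Prop1Explicit B7Prop2Explicit MatrixNorms
open T4AveragingDeficitWall (IsUnitaryCfg Ad)
open T4AveragingDeficitWallBoundary (periodBox)
open T4AveragingDeficitNonAbelian (Ad_mul Ad_sub)
open AveragingDeficitHSInner (nhsNormSq_Ad)
open AveragingDeficitCovGrad (covFd)
open NE3CovariantCalculus (nhsNormSq_sub_le)
open NE3CovariantLineSumCore (nhsNormSq_sum_le_card_mul)
open NE3CovariantLineAdjoint (cornerToBond cornerToBond_mem cornerToBond_add_e)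
open NE3CovariantBlockDivergence (sum_periodBox_eq_sum_split)
open NE3StraightAverageAdjoint (tbase)

noncomputable section

variable {d : ℕ} {n : Type*} [Fintype n] [DecidableEq n]

/-! ## §1 The 1D trace inequality in nhs currency -/

omit [Fintype n] [DecidableEq n] in
/-- Telescoping from `j ≤ M − 1`: `f (M−1) − f j = Σ_{i ∈ Ico j (M−1)} (f (i+1) − f i)`. [folklore] -/
theorem sub_eq_sum_Ico (f : ℕ → Matrix n n ℂ) {M j : ℕ} (hj : j ≤ M - 1) :
    f (M - 1) - f j = ∑ i ∈ Ico j (M - 1), (f (i + 1) - f i) := by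
  rw [Finset.sum_Ico_eq_sum_range]
  have h := Finset.sum_range_sub (fun k => f (j + k)) (M - 1 - j)
  simp only [Nat.add_sub_cancel' hj, add_zero] at h
  rw [← h]
  exact sum_congr rfl fun k _ => by rw [add_assoc]

/-- **THE 1D TRACE INEQUALITY** (`M ≥ 1`): `nhsNormSq (f (M−1)) ≤ (2∕M)·Σ_{j<M} nhsNormSq (f j) + 2M·Σ_{j<M} nhsNormSq (f (j+1) − f j)`.
[folklore] -/
theorem nhsNormSq_last_le [Nonempty n] {M : ℕ} (hM : 1 ≤ M) (f : ℕ → Matrix n n ℂ) :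
    nhsNormSq (f (M - 1)) ≤ 2 / (M : ℝ) * ∑ j ∈ range M, nhsNormSq (f j)
      + 2 * (M : ℝ) * ∑ j ∈ range M, nhsNormSq (f (j + 1) - f j) := by
  have hM0 : (0 : ℝ) < M := by exact_mod_cast (by omega : 0 < M)
  set D : ℝ := ∑ j ∈ range M, nhsNormSq (f (j + 1) - f j) with hD
  have hD0 : 0 ≤ D := sum_nonneg fun _ _ => nhsNormSq_nonneg _
  -- from every base point j < M
  have hj : ∀ j ∈ range M, nhsNormSq (f (M - 1)) ≤ 2 * nhsNormSq (f j) + 2 * ((M : ℝ) * D) := by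
    intro j hjm
    rw [mem_range] at hjm
    have hjle : j ≤ M - 1 := by omega
    have hsplit : f (M - 1) = f j + (f (M - 1) - f j) := by abel
    have h1 : nhsNormSq (f (M - 1)) ≤ 2 * (nhsNormSq (f j) + nhsNormSq (f (M - 1) - f j)) := by
      rw [hsplit, add_sub_cancel_left]
      exact NE3CovariantLineSumCore.nhsNormSq_add_le _ _
    have h2 : nhsNormSq (f (M - 1) - f j) ≤ (M : ℝ) * D := by
      rw [sub_eq_sum_Ico f hjle]
      refine (nhsNormSq_sum_le_card_mul _ _).trans ?_
      have hcard : (((Ico j (M - 1)).card : ℕ) : ℝ) ≤ M := by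
        rw [Nat.card_Ico]; exact_mod_cast (by omega : M - 1 - j ≤ M)
      have hsub : ∑ i ∈ Ico j (M - 1), nhsNormSq (f (i + 1) - f i) ≤ D :=
        sum_le_sum_of_subset_of_nonneg (fun i hi => by rw [mem_Ico] at hi; rw [mem_range]; omega)
          fun _ _ _ => nhsNormSq_nonneg _
      exact mul_le_mul hcard hsub (sum_nonneg fun _ _ => nhsNormSq_nonneg _) hM0.le
    linarith
  -- average over j
  have hsum := sum_le_sum hj
  rw [sum_const, card_range, nsmul_eq_mul, sum_add_distrib, sum_const, card_range, nsmul_eq_mul, ← mul_sum] at hsum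
  rw [div_mul_eq_mul_div, hD]
  have : nhsNormSq (f (M - 1)) = ((M : ℝ) * nhsNormSq (f (M - 1))) / M := by field_simp
  rw [this]
  have h3 : (M : ℝ) * nhsNormSq (f (M - 1)) ≤ 2 * ∑ j ∈ range M, nhsNormSq (f j) + (M : ℝ) * (2 * ((M : ℝ) * D)) := hsum
  calc (M : ℝ) * nhsNormSq (f (M - 1)) / M ≤ (2 * ∑ j ∈ range M, nhsNormSq (f j) + (M : ℝ) * (2 * ((M : ℝ) * D))) / M := by
        gcongr
    _ = 2 * (∑ j ∈ range M, nhsNormSq (f j)) / M + 2 * (M : ℝ) * D := by field_simp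

/-! ## §2 The covariant instance on a block -/

/-- The corner readings of the `κ`-component along a `κ`-line: `f j := Ad (cornerToBond W M z (y_j) κ)⁻¹ (η y_j κ)`, `y_j = q + t + j•e_κ`.
Consecutive readings differ by the transported covariant difference. [folklore] -/
theorem cornerRead_succ_sub (W : Site d → Fin d → (Matrix n n ℂ)ˣ) (M : ℕ) (z t : Site d) (κ : Fin d) (η : Site d → Fin d → Matrix n n ℂ)
    (j : ℕ) :
    Ad (cornerToBond W M z ((M : ℤ) • z + t + ((j + 1 : ℕ) : ℤ) • e κ) κ)⁻¹ (η ((M : ℤ) • z + t + ((j + 1 : ℕ) : ℤ) • e κ) κ)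
        - Ad (cornerToBond W M z ((M : ℤ) • z + t + (j : ℤ) • e κ) κ)⁻¹ (η ((M : ℤ) • z + t + (j : ℤ) • e κ) κ)
      = Ad (cornerToBond W M z ((M : ℤ) • z + t + (j : ℤ) • e κ) κ)⁻¹
          (Ad (W ((M : ℤ) • z + t + (j : ℤ) • e κ + e κ) κ) (η ((M : ℤ) • z + t + (j : ℤ) • e κ + e κ) κ)
            - η ((M : ℤ) • z + t + (j : ℤ) • e κ) κ) := by
  have hy : (M : ℤ) • z + t + ((j + 1 : ℕ) : ℤ) • e κ = ((M : ℤ) • z + t + (j : ℤ) • e κ) + e κ := by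
    push_cast; rw [add_smul, one_smul]; abel
  rw [hy, cornerToBond_add_e, mul_inv_rev, inv_inv, Ad_sub, ← Ad_mul]

/-- `nhsNormSq` of the covariant `κκ`-difference: `nhsNormSq (Ad_{W(y+e_κ,κ)} η(y+e_κ,κ) − η(y,κ)) = nhsNormSq (covFd W η y κ κ)`
(unitary `W`). [folklore] -/
theorem nhsNormSq_covDiff_eq {W : Site d → Fin d → (Matrix n n ℂ)ˣ} (hW : IsUnitaryCfg W) (η : Site d → Fin d → Matrix n n ℂ)
    (y : Site d) (κ : Fin d) :
    nhsNormSq (Ad (W (y + e κ) κ) (η (y + e κ) κ) - η y κ) = nhsNormSq (covFd W η y κ κ) := by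
  unfold covFd
  rw [Ad_mul, ← Ad_sub, nhsNormSq_Ad (hW y κ)]

/-- **THE COVARIANT TRACE INEQUALITY ALONG ONE `κ`-LINE OF THE BLOCK** (unitary `W`, `M ≥ 1`, transverse offset `t`):
`nhsNormSq (η (q+t+(M−1)e_κ) κ) ≤ (2∕M)·Σ_{j<M} nhsNormSq (η (q+t+je_κ) κ) + 2M·Σ_{j<M} nhsNormSq (covFd W η (q+t+je_κ) κ κ)`. [folklore] -/
theorem nhsNormSq_farBond_le [Nonempty n] {M : ℕ} (hM : 1 ≤ M) {W : Site d → Fin d → (Matrix n n ℂ)ˣ} (hW : IsUnitaryCfg W)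
    (η : Site d → Fin d → Matrix n n ℂ) (z t : Site d) (κ : Fin d) :
    nhsNormSq (η ((M : ℤ) • z + t + ((M : ℤ) - 1) • e κ) κ)
      ≤ 2 / (M : ℝ) * ∑ j ∈ range M, nhsNormSq (η ((M : ℤ) • z + t + (j : ℤ) • e κ) κ)
        + 2 * (M : ℝ) * ∑ j ∈ range M, nhsNormSq (covFd W η ((M : ℤ) • z + t + (j : ℤ) • e κ) κ κ) := by
  set f : ℕ → Matrix n n ℂ :=
    fun j => Ad (cornerToBond W M z ((M : ℤ) • z + t + (j : ℤ) • e κ) κ)⁻¹ (η ((M : ℤ) • z + t + (j : ℤ) • e κ) κ) with hf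
  have h := nhsNormSq_last_le hM f
  have hval : ∀ j : ℕ, nhsNormSq (f j) = nhsNormSq (η ((M : ℤ) • z + t + (j : ℤ) • e κ) κ) := fun j =>
    nhsNormSq_Ad ((unitaryUnits _).inv_mem (cornerToBond_mem hW M z _ κ)) _
  have hdiff : ∀ j : ℕ, nhsNormSq (f (j + 1) - f j) = nhsNormSq (covFd W η ((M : ℤ) • z + t + (j : ℤ) • e κ) κ κ) := by
    intro j
    simp only [hf]
    rw [cornerRead_succ_sub, nhsNormSq_Ad ((unitaryUnits _).inv_mem (cornerToBond_mem hW M z _ κ)), nhsNormSq_covDiff_eq hW]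
  have hlast : ((M - 1 : ℕ) : ℤ) = (M : ℤ) - 1 := by omega
  simp only [hval, hdiff, hlast] at h
  exact h

/-- **THE DISCRETE COVARIANT TRACE INEQUALITY, FAR `κ`-FACE OF `B(z)`** (unitary `W`, `M ≥ 1`, ANY `η`):
`Σ_t nhsNormSq (η (M•z+t+(M−1)e_κ) κ) ≤ (2∕M)·Σ_{v∈periodBox M} nhsNormSq (η (M•z+v) κ) + 2M·Σ_{v∈periodBox M} nhsNormSq (covFd W η (M•z+v) κ κ)`.
[folklore] -/
theorem sum_nhsNormSq_farFace_le [Nonempty n] {M : ℕ} (hM : 1 ≤ M) {W : Site d → Fin d → (Matrix n n ℂ)ˣ} (hW : IsUnitaryCfg W)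
    (η : Site d → Fin d → Matrix n n ℂ) (z : Site d) (κ : Fin d) :
    ∑ r' : {j : Fin d // j ≠ κ} → Fin M, nhsNormSq (η ((M : ℤ) • z + tbase κ r' + ((M : ℤ) - 1) • e κ) κ)
      ≤ 2 / (M : ℝ) * ∑ v ∈ periodBox (d := d) M, nhsNormSq (η ((M : ℤ) • z + v) κ)
        + 2 * (M : ℝ) * ∑ v ∈ periodBox (d := d) M, nhsNormSq (covFd W η ((M : ℤ) • z + v) κ κ) := by
  rw [sum_periodBox_eq_sum_split M κ (fun v => nhsNormSq (η ((M : ℤ) • z + v) κ)),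
    sum_periodBox_eq_sum_split M κ (fun v => nhsNormSq (covFd W η ((M : ℤ) • z + v) κ κ)), mul_sum, mul_sum, ← sum_add_distrib]
  refine sum_le_sum fun r' _ => ?_
  have h := nhsNormSq_farBond_le hM hW η z (tbase κ r') κ
  rw [Fin.sum_univ_eq_sum_range (fun a => nhsNormSq (η ((M : ℤ) • z + (tbase κ r' + ((a : ℕ) : ℤ) • e κ)) κ)) M,
    Fin.sum_univ_eq_sum_range (fun a => nhsNormSq (covFd W η ((M : ℤ) • z + (tbase κ r' + ((a : ℕ) : ℤ) • e κ)) κ κ)) M]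
  simp only [← add_assoc]
  exact h

/-- **… AND THE NEAR `κ`-FACE OF `B(z)`** = the far face of `B(z − e_κ)`:
`Σ_t nhsNormSq (η (M•z+t−e_κ) κ) ≤ (2∕M)·Σ_{v} nhsNormSq (η (M•(z−e_κ)+v) κ) + 2M·Σ_{v} nhsNormSq (covFd W η (M•(z−e_κ)+v) κ κ)`. [folklore] -/
theorem sum_nhsNormSq_nearFace_le [Nonempty n] {M : ℕ} (hM : 1 ≤ M) {W : Site d → Fin d → (Matrix n n ℂ)ˣ} (hW : IsUnitaryCfg W)
    (η : Site d → Fin d → Matrix n n ℂ) (z : Site d) (κ : Fin d) :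
    ∑ r' : {j : Fin d // j ≠ κ} → Fin M, nhsNormSq (η ((M : ℤ) • z + tbase κ r' - e κ) κ)
      ≤ 2 / (M : ℝ) * ∑ v ∈ periodBox (d := d) M, nhsNormSq (η ((M : ℤ) • (z - e κ) + v) κ)
        + 2 * (M : ℝ) * ∑ v ∈ periodBox (d := d) M, nhsNormSq (covFd W η ((M : ℤ) • (z - e κ) + v) κ κ) := by
  have h := sum_nhsNormSq_farFace_le hM hW η (z - e κ) κ
  have hre : ∀ r' : {j : Fin d // j ≠ κ} → Fin M,
      (M : ℤ) • (z - e κ) + tbase κ r' + ((M : ℤ) - 1) • e κ = (M : ℤ) • z + tbase κ r' - e κ := by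
    intro r'; rw [smul_sub, sub_smul, one_smul]; abel
  simp only [hre] at h
  exact h

end

end Summit.QuantumFields.BalabanUV.T4Continuum.NE3CovariantBlockTrace
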